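import Mathlib
import Summits.NavierStokesRegularity.NavierStokesRegularity.Theorems.WakeRatchetTailRatchetRelayNonlinearEstimates
import HarnessLib

/-!
# `WakeRatchet.TailRatchet` (stmt-NavierStokesRegularity-21808): the NONLINEAR FORCING MAP of the lacunary
# front construction — fixed-point reformulation, size and Lipschitz bounds in the weighted class

Support file for the crux `TailRatchet` (route `WakeRatchet`; MODEL lattice ODEs of Tao 2016 §1.2, §4 —
nothing in this file is a statement about the Navier–Stokes equations, and no item is closed here).

Context (census of stmt-21808, programme "R-lac", assembly): with `b = e^{t} + h` at fixed time ratio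
`s ∈ [3/2,2]`, the front equation `G_δ(b,s) = b' − (4/s²)b(t/s)² + 4sδ·b(t)b(st) = 0` is EQUIVALENT
(`front_iff_bordered`) to the drain-bordered linear problem with a nonlinear right-hand side,
`h' − 2e^{t/2}h(t/2) + δ·8e^{3t} = N_s(h,δ)(t)`,
`N_s(h,δ) := −(e^{t}−(4/s²)e^{2t/s}) − (2e^{t/2}h(t/2) − (8/s²)e^{t/s}h(t/s)) + (4/s²)h(t/s)²
            − δ·(4s(e^{t}+h(t))(e^{st}+h(st)) − 8e^{3t})`,
so that fronts are the fixed points `(h,δ) = M⁻¹N_s(h,δ)` of the drain-bordered inverse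
(`…RelayInverseBound`).  This file proves, sorry-free, the two properties of `N_s` the contraction needs,
assembling `…RelayFrozenDilation` and `…RelayNonlinearEstimates`:

* `drain_base_mismatch` — `|4s·e^{t}e^{st} − 8e^{3t}| ≤ 6|s−2|e^{t/2}`;
* `front_iff_bordered` — the algebraic equivalence above (pointwise identity of right-hand sides);
* `forcing_bound` — on `{|h| ≤ ρe^{ξ/2}, |h'| ≤ De^{ξ/2}, |δ| ≤ δ₀}`:
  `|N_s(h,δ)(t)| ≤ (4|s−2| + |s−2|(9ρ+7D) + 4ρ² + δ₀(16(1+ρ)ρ + 6|s−2|))·e^{t/2}`;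
* `forcing_lipschitz` — `|N_s(h₁,δ₁) − N_s(h₂,δ₂)| ≤ (|s−2|(9d+7d′) + 4ρd + δ₀·16(1+ρ)d
  + |δ₁−δ₂|(16(1+ρ)ρ + 6|s−2|))·e^{t/2}` where `d, d′` bound `h₁−h₂` and `h₁'−h₂'` in the weights.

Both are `O(|s−2|) + O(|s−2|·size) + O(size²)`: with the explicit operator bound `K` of
`…RelayInverseBound` the map `M⁻¹N_s` is a self-map and a contraction of the ball of radius `≍ K|s−2|` once
`|s−2| ≤ c/K²`.  Remaining: the metric-space plumbing (closed subset of `(ℝ →ᵇ ℝ)²`, `ContractingWith`) and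
the sign `δ_s > 0` for `s < 2`; lacunary fronts do NOT refute `TailRatchet` (which needs `Λ → 1`).

HONEST FRAMING: elementary inequalities; MODEL lattice only; the construction item and the crux stay open.
-/

noncomputable section

set_option linter.dupNamespace false

namespace Summit.NavierStokesRegularity.NavierStokesRegularity.Theorems

namespace WakeRatchetRelayNonlinearMap

open Set Filter Topology Real
open WakeRatchetRelayFrozenDilation WakeRatchetRelayNonlinearEstimates

/-! ## The drain base mismatch -/

/-- `|4s·e^{t}e^{st} − 8e^{3t}| ≤ 6|s−2|e^{t/2}` for `3/2 ≤ s`, `t ≤ 0`. [folklore] -/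
theorem drain_base_mismatch {s : ℝ} (hs1 : 3 / 2 ≤ s) {t : ℝ} (ht : t ≤ 0) :
    |4 * s * (Real.exp t * Real.exp (s * t)) - 8 * Real.exp (3 * t)| ≤ 6 * |s - 2| * Real.exp (t / 2) := by
  have hs0 : 0 < s := by linarith
  have hprod : Real.exp t * Real.exp (s * t) = Real.exp ((1 + s) * t) := by rw [← Real.exp_add]; ring_nf
  rw [hprod]
  -- `(1+s)t ≥ 3t` and both `≤ 5t/2 ≤ 0`
  have ha : (1 + s) * t ≤ 5 / 2 * t := by nlinarith
  have hb : 3 * t ≤ 5 / 2 * t := by linarith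
  have hexp := exp_sub_exp_abs_le ha hb
  have hsplit : 4 * s * Real.exp ((1 + s) * t) - 8 * Real.exp (3 * t) =
      (4 * s - 8) * Real.exp ((1 + s) * t) + 8 * (Real.exp ((1 + s) * t) - Real.exp (3 * t)) := by ring
  rw [hsplit]
  have h1 : |(4 * s - 8) * Real.exp ((1 + s) * t)| ≤ 4 * |s - 2| * Real.exp (t / 2) := by
    rw [abs_mul, abs_of_pos (Real.exp_pos _), show 4 * s - 8 = 4 * (s - 2) by ring, abs_mul,
      show |(4 : ℝ)| = 4 by norm_num]
    have : Real.exp ((1 + s) * t) ≤ Real.exp (t / 2) := Real.exp_le_exp.2 (by nlinarith)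
    exact mul_le_mul_of_nonneg_left this (by positivity)
  have h2 : |8 * (Real.exp ((1 + s) * t) - Real.exp (3 * t))| ≤ 2 * |s - 2| * Real.exp (t / 2) := by
    rw [abs_mul, show |(8 : ℝ)| = 8 by norm_num]
    have hd : |(1 + s) * t - 3 * t| = |s - 2| * |t| := by
      rw [show (1 + s) * t - 3 * t = (s - 2) * t by ring, abs_mul]
    have hte : |t| * Real.exp (2 * t) ≤ 1 / (2 * 2) := abs_mul_exp_mul_le (by norm_num) ht
    have he : Real.exp (5 / 2 * t) = Real.exp (t / 2) * Real.exp (2 * t) := by rw [← Real.exp_add]; ring_nf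
    calc 8 * |Real.exp ((1 + s) * t) - Real.exp (3 * t)| ≤ 8 * (Real.exp (5 / 2 * t) * (|s - 2| * |t|)) := by
          rw [← hd]; exact mul_le_mul_of_nonneg_left hexp (by norm_num)
      _ = 8 * |s - 2| * Real.exp (t / 2) * (|t| * Real.exp (2 * t)) := by rw [he]; ring
      _ ≤ 8 * |s - 2| * Real.exp (t / 2) * (1 / (2 * 2)) := mul_le_mul_of_nonneg_left hte (by positivity)
      _ = 2 * |s - 2| * Real.exp (t / 2) := by ring
  calc |(4 * s - 8) * Real.exp ((1 + s) * t) + 8 * (Real.exp ((1 + s) * t) - Real.exp (3 * t))|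
      ≤ |(4 * s - 8) * Real.exp ((1 + s) * t)| + |8 * (Real.exp ((1 + s) * t) - Real.exp (3 * t))| :=
        abs_add_le _ _
    _ ≤ 4 * |s - 2| * Real.exp (t / 2) + 2 * |s - 2| * Real.exp (t / 2) := add_le_add h1 h2
    _ = 6 * |s - 2| * Real.exp (t / 2) := by ring

/-! ## Fixed-point reformulation -/

/-- **`G_δ(e^{t}+h, s) = 0 ⇔ L₀h + δ·8e^{3t} = N_s(h,δ)`** — the pointwise identity between the derivative
prescribed by the front equation and the drain-bordered form with the nonlinear forcing `N_s`. [folklore] -/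
theorem front_iff_bordered {s δ : ℝ} {h : ℝ → ℝ} (t : ℝ) :
    (4 / s ^ 2 * (Real.exp (t / s) + h (t / s)) ^ 2 -
        4 * s * δ * ((Real.exp t + h t) * (Real.exp (s * t) + h (s * t))) - Real.exp t) =
      2 * Real.exp (t / 2) * h (t / 2) +
        ((-(Real.exp t - 4 / s ^ 2 * Real.exp (2 * t / s)) -
            (2 * Real.exp (t / 2) * h (t / 2) - 8 / s ^ 2 * Real.exp (t / s) * h (t / s)) +
            4 / s ^ 2 * h (t / s) ^ 2 -
            δ * (4 * s * ((Real.exp t + h t) * (Real.exp (s * t) + h (s * t))) - 8 * Real.exp (3 * t))) -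
          δ * (8 * Real.exp (3 * t))) := by
  have h2 : Real.exp (2 * t / s) = Real.exp (t / s) ^ 2 := by
    rw [sq, ← Real.exp_add]; ring_nf
  rw [h2]
  ring

/-! ## Size of the forcing -/

/-- **FORCING BOUND.**  For `3/2 ≤ s ≤ 2`, `h` differentiable on `t<0` with `|h(ξ)| ≤ ρe^{ξ/2}` (`ξ ≤ 0`),
`|h'(ξ)| ≤ De^{ξ/2}` (`ξ < 0`), and `|δ| ≤ δ₀`: for every `t < 0`,
`|N_s(h,δ)(t)| ≤ (4|s−2| + |s−2|(9ρ+7D) + 4ρ² + δ₀(16(1+ρ)ρ + 6|s−2|))·e^{t/2}`.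
[cite: Tao2016AveragedNS, §1.2 (dyadic model); cell vocabulary (programme R-lac, assembly)] -/
theorem forcing_bound {s : ℝ} (hs1 : 3 / 2 ≤ s) (hs2 : s ≤ 2) {h h' : ℝ → ℝ} {ρ D δ δ₀ : ℝ}
    (hd : ∀ ξ : ℝ, ξ < 0 → HasDerivAt h (h' ξ) ξ)
    (hρ : ∀ ξ : ℝ, ξ ≤ 0 → |h ξ| ≤ ρ * Real.exp (ξ / 2))
    (hD : ∀ ξ : ℝ, ξ < 0 → |h' ξ| ≤ D * Real.exp (ξ / 2)) (hδ : |δ| ≤ δ₀) {t : ℝ} (ht : t < 0) :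
    |(-(Real.exp t - 4 / s ^ 2 * Real.exp (2 * t / s)) -
        (2 * Real.exp (t / 2) * h (t / 2) - 8 / s ^ 2 * Real.exp (t / s) * h (t / s)) +
        4 / s ^ 2 * h (t / s) ^ 2 -
        δ * (4 * s * ((Real.exp t + h t) * (Real.exp (s * t) + h (s * t))) - 8 * Real.exp (3 * t)))| ≤
      (4 * |s - 2| + |s - 2| * (9 * ρ + 7 * D) + 4 * ρ ^ 2 +
        δ₀ * (16 * (1 + ρ) * ρ + 6 * |s - 2|)) * Real.exp (t / 2) := by
  have hρ0 : 0 ≤ ρ := by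
    have := hρ 0 le_rfl; rw [zero_div, Real.exp_zero, mul_one] at this; exact (abs_nonneg _).trans this
  have hδ0 : 0 ≤ δ₀ := (abs_nonneg _).trans hδ
  have e0 : 0 < Real.exp (t / 2) := Real.exp_pos _
  -- the four pieces
  have h1 := residual_abs_le hs1 hs2 ht.le
  have h2 := frozen_dilation_estimate hs1 (by linarith) hd hρ hD ht
  have h3 : |4 / s ^ 2 * h (t / s) ^ 2| ≤ 4 * ρ * ρ * Real.exp (t / 2) := by
    have := quadratic_lipschitz hs1 hs2 (h₁ := h) (h₂ := fun _ => 0) (d := ρ) hρ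
      (fun ξ _ => by rw [abs_zero]; positivity) (fun ξ hξ => by rw [sub_zero]; exact hρ ξ hξ) ht.le
    simpa using this
  have h4a := drain_lipschitz hs1 hs2 (h₁ := h) (h₂ := fun _ => 0) (ρ := ρ) (d := ρ) hρ
    (fun ξ _ => by rw [abs_zero]; positivity) (fun ξ hξ => by rw [sub_zero]; exact hρ ξ hξ) ht.le
  simp only [add_zero] at h4a
  have h4b := drain_base_mismatch hs1 ht.le
  have h4 : |4 * s * ((Real.exp t + h t) * (Real.exp (s * t) + h (s * t))) - 8 * Real.exp (3 * t)| ≤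
      (16 * (1 + ρ) * ρ + 6 * |s - 2|) * Real.exp (t / 2) := by
    have hsplit : 4 * s * ((Real.exp t + h t) * (Real.exp (s * t) + h (s * t))) - 8 * Real.exp (3 * t) =
        4 * s * ((Real.exp t + h t) * (Real.exp (s * t) + h (s * t)) -
          Real.exp t * Real.exp (s * t)) +
        (4 * s * (Real.exp t * Real.exp (s * t)) - 8 * Real.exp (3 * t)) := by ring
    rw [hsplit]
    calc _ ≤ |4 * s * ((Real.exp t + h t) * (Real.exp (s * t) + h (s * t)) -
            Real.exp t * Real.exp (s * t))| +
          |4 * s * (Real.exp t * Real.exp (s * t)) - 8 * Real.exp (3 * t)| := abs_add_le _ _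
      _ ≤ 16 * (1 + ρ) * ρ * Real.exp (t / 2) + 6 * |s - 2| * Real.exp (t / 2) := add_le_add h4a h4b
      _ = (16 * (1 + ρ) * ρ + 6 * |s - 2|) * Real.exp (t / 2) := by ring
  have h4' : |δ * (4 * s * ((Real.exp t + h t) * (Real.exp (s * t) + h (s * t))) - 8 * Real.exp (3 * t))| ≤
      δ₀ * ((16 * (1 + ρ) * ρ + 6 * |s - 2|) * Real.exp (t / 2)) := by
    rw [abs_mul]; exact mul_le_mul hδ h4 (abs_nonneg _) hδ0
  -- assemble with the triangle inequality
  have tri : ∀ a b c d : ℝ, |-a - b + c - d| ≤ |a| + |b| + |c| + |d| := by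
    intro a b c d
    calc |-a - b + c - d| ≤ |-a - b + c| + |d| := abs_sub _ _
      _ ≤ |-a - b| + |c| + |d| := by linarith [abs_add_le (-a - b) c]
      _ ≤ |-a| + |b| + |c| + |d| := by linarith [abs_sub (-a) b]
      _ = |a| + |b| + |c| + |d| := by rw [abs_neg]
  refine (tri _ _ _ _).trans ?_
  nlinarith [h1, h2, h3, h4', e0, abs_nonneg (s - 2)]

/-! ## Lipschitz bound of the forcing -/

/-- **FORCING LIPSCHITZ BOUND.**  For `3/2 ≤ s ≤ 2`, pairs `(h₁,δ₁)`, `(h₂,δ₂)` with `|hᵢ| ≤ ρe^{ξ/2}`,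
`|δ₁| ≤ δ₀`, and `|h₁−h₂| ≤ d·e^{ξ/2}` (`ξ ≤ 0`), `|(h₁−h₂)'| ≤ d′e^{ξ/2}` (`ξ<0`): for every `t < 0`,
`|N_s(h₁,δ₁)(t) − N_s(h₂,δ₂)(t)| ≤ (|s−2|(9d+7d′) + 4ρd + δ₀·16(1+ρ)d + |δ₁−δ₂|(16(1+ρ)ρ + 6|s−2|))e^{t/2}`.
[cite: Tao2016AveragedNS, §1.2 (dyadic model); cell vocabulary (programme R-lac, assembly)] -/
theorem forcing_lipschitz {s : ℝ} (hs1 : 3 / 2 ≤ s) (hs2 : s ≤ 2) {h₁ h₂ e' : ℝ → ℝ}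
    {ρ d d' δ₁ δ₂ δ₀ : ℝ}
    (hρ₁ : ∀ ξ : ℝ, ξ ≤ 0 → |h₁ ξ| ≤ ρ * Real.exp (ξ / 2))
    (hρ₂ : ∀ ξ : ℝ, ξ ≤ 0 → |h₂ ξ| ≤ ρ * Real.exp (ξ / 2))
    (hdiff : ∀ ξ : ℝ, ξ < 0 → HasDerivAt (fun x => h₁ x - h₂ x) (e' ξ) ξ)
    (hd : ∀ ξ : ℝ, ξ ≤ 0 → |h₁ ξ - h₂ ξ| ≤ d * Real.exp (ξ / 2))
    (hd' : ∀ ξ : ℝ, ξ < 0 → |e' ξ| ≤ d' * Real.exp (ξ / 2))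
    (hδ₁ : |δ₁| ≤ δ₀) {t : ℝ} (ht : t < 0) :
    abs ((-(Real.exp t - 4 / s ^ 2 * Real.exp (2 * t / s)) -
        (2 * Real.exp (t / 2) * h₁ (t / 2) - 8 / s ^ 2 * Real.exp (t / s) * h₁ (t / s)) +
        4 / s ^ 2 * h₁ (t / s) ^ 2 -
        δ₁ * (4 * s * ((Real.exp t + h₁ t) * (Real.exp (s * t) + h₁ (s * t))) - 8 * Real.exp (3 * t))) -
      ((-(Real.exp t - 4 / s ^ 2 * Real.exp (2 * t / s)) -
        (2 * Real.exp (t / 2) * h₂ (t / 2) - 8 / s ^ 2 * Real.exp (t / s) * h₂ (t / s)) +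
        4 / s ^ 2 * h₂ (t / s) ^ 2 -
        δ₂ * (4 * s * ((Real.exp t + h₂ t) * (Real.exp (s * t) + h₂ (s * t))) - 8 * Real.exp (3 * t))))) ≤
      (|s - 2| * (9 * d + 7 * d') + 4 * ρ * d + δ₀ * (16 * (1 + ρ) * d) +
        |δ₁ - δ₂| * (16 * (1 + ρ) * ρ + 6 * |s - 2|)) * Real.exp (t / 2) := by
  have hρ0 : 0 ≤ ρ := by
    have := hρ₁ 0 le_rfl; rw [zero_div, Real.exp_zero, mul_one] at this; exact (abs_nonneg _).trans this
  have hd0 : 0 ≤ d := by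
    have := hd 0 le_rfl; rw [zero_div, Real.exp_zero, mul_one] at this; exact (abs_nonneg _).trans this
  have hδ0 : 0 ≤ δ₀ := (abs_nonneg _).trans hδ₁
  have e0 : 0 < Real.exp (t / 2) := Real.exp_pos _
  -- frozen dilation on the difference
  have hL := frozen_dilation_estimate hs1 (by linarith) (η := fun x => h₁ x - h₂ x) (η' := e')
    hdiff hd hd' ht
  -- quadratic
  have hQ := quadratic_lipschitz hs1 hs2 hρ₁ hρ₂ hd ht.le
  -- drain: D(h₁) − D(h₂) and D(h₂) − base
  have hD12 := drain_lipschitz hs1 hs2 hρ₁ hρ₂ hd ht.le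
  have hD2a := drain_lipschitz hs1 hs2 (h₁ := h₂) (h₂ := fun _ => 0) (ρ := ρ) (d := ρ) hρ₂
    (fun ξ _ => by rw [abs_zero]; positivity) (fun ξ hξ => by rw [sub_zero]; exact hρ₂ ξ hξ) ht.le
  simp only [add_zero] at hD2a
  have hD2b := drain_base_mismatch hs1 ht.le
  have hD2 : |4 * s * ((Real.exp t + h₂ t) * (Real.exp (s * t) + h₂ (s * t))) - 8 * Real.exp (3 * t)| ≤
      (16 * (1 + ρ) * ρ + 6 * |s - 2|) * Real.exp (t / 2) := by
    have hsplit : 4 * s * ((Real.exp t + h₂ t) * (Real.exp (s * t) + h₂ (s * t))) - 8 * Real.exp (3 * t) =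
        4 * s * ((Real.exp t + h₂ t) * (Real.exp (s * t) + h₂ (s * t)) -
          Real.exp t * Real.exp (s * t)) +
        (4 * s * (Real.exp t * Real.exp (s * t)) - 8 * Real.exp (3 * t)) := by ring
    rw [hsplit]
    calc _ ≤ |4 * s * ((Real.exp t + h₂ t) * (Real.exp (s * t) + h₂ (s * t)) -
            Real.exp t * Real.exp (s * t))| +
          |4 * s * (Real.exp t * Real.exp (s * t)) - 8 * Real.exp (3 * t)| := abs_add_le _ _
      _ ≤ 16 * (1 + ρ) * ρ * Real.exp (t / 2) + 6 * |s - 2| * Real.exp (t / 2) := add_le_add hD2a hD2b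
      _ = (16 * (1 + ρ) * ρ + 6 * |s - 2|) * Real.exp (t / 2) := by ring
  -- regroup the difference
  set R := Real.exp t - 4 / s ^ 2 * Real.exp (2 * t / s) with hR
  set Lh₁ := 2 * Real.exp (t / 2) * h₁ (t / 2) - 8 / s ^ 2 * Real.exp (t / s) * h₁ (t / s) with hL₁
  set Lh₂ := 2 * Real.exp (t / 2) * h₂ (t / 2) - 8 / s ^ 2 * Real.exp (t / s) * h₂ (t / s) with hL₂
  set Q₁ := 4 / s ^ 2 * h₁ (t / s) ^ 2 with hQ₁
  set Q₂ := 4 / s ^ 2 * h₂ (t / s) ^ 2 with hQ₂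
  set D₁ := 4 * s * ((Real.exp t + h₁ t) * (Real.exp (s * t) + h₁ (s * t))) with hD₁
  set D₂ := 4 * s * ((Real.exp t + h₂ t) * (Real.exp (s * t) + h₂ (s * t))) with hD₂'
  set E := 8 * Real.exp (3 * t) with hE
  have hLdiff : |Lh₁ - Lh₂| ≤ |s - 2| * (9 * d + 7 * d') * Real.exp (t / 2) := by
    have : Lh₁ - Lh₂ = 2 * Real.exp (t / 2) * (h₁ (t / 2) - h₂ (t / 2)) -
        8 / s ^ 2 * Real.exp (t / s) * (h₁ (t / s) - h₂ (t / s)) := by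
      simp only [hL₁, hL₂]; ring
    rw [this]; exact hL
  have hQdiff : |Q₁ - Q₂| ≤ 4 * ρ * d * Real.exp (t / 2) := by
    have : Q₁ - Q₂ = 4 / s ^ 2 * (h₁ (t / s) ^ 2 - h₂ (t / s) ^ 2) := by simp only [hQ₁, hQ₂]; ring
    rw [this]; exact hQ
  have hDdiff : |D₁ - D₂| ≤ 16 * (1 + ρ) * d * Real.exp (t / 2) := by
    have : D₁ - D₂ = 4 * s * ((Real.exp t + h₁ t) * (Real.exp (s * t) + h₁ (s * t)) -
        (Real.exp t + h₂ t) * (Real.exp (s * t) + h₂ (s * t))) := by simp only [hD₁, hD₂']; ring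
    rw [this]; exact hD12
  have halg : (-R - Lh₁ + Q₁ - δ₁ * (D₁ - E)) - (-R - Lh₂ + Q₂ - δ₂ * (D₂ - E)) =
      -(Lh₁ - Lh₂) + (Q₁ - Q₂) - δ₁ * (D₁ - D₂) - (δ₁ - δ₂) * (D₂ - E) := by ring
  rw [halg]
  have t1 : |δ₁ * (D₁ - D₂)| ≤ δ₀ * (16 * (1 + ρ) * d * Real.exp (t / 2)) := by
    rw [abs_mul]; exact mul_le_mul hδ₁ hDdiff (abs_nonneg _) hδ0
  have t2 : |(δ₁ - δ₂) * (D₂ - E)| ≤ |δ₁ - δ₂| * ((16 * (1 + ρ) * ρ + 6 * |s - 2|) * Real.exp (t / 2)) := by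
    rw [abs_mul]; exact mul_le_mul_of_nonneg_left hD2 (abs_nonneg _)
  calc |-(Lh₁ - Lh₂) + (Q₁ - Q₂) - δ₁ * (D₁ - D₂) - (δ₁ - δ₂) * (D₂ - E)|
      ≤ |-(Lh₁ - Lh₂) + (Q₁ - Q₂) - δ₁ * (D₁ - D₂)| + |(δ₁ - δ₂) * (D₂ - E)| := abs_sub _ _
    _ ≤ |-(Lh₁ - Lh₂) + (Q₁ - Q₂)| + |δ₁ * (D₁ - D₂)| + |(δ₁ - δ₂) * (D₂ - E)| := by
        linarith [abs_sub (-(Lh₁ - Lh₂) + (Q₁ - Q₂)) (δ₁ * (D₁ - D₂))]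
    _ ≤ |Lh₁ - Lh₂| + |Q₁ - Q₂| + |δ₁ * (D₁ - D₂)| + |(δ₁ - δ₂) * (D₂ - E)| := by
        have := abs_add_le (-(Lh₁ - Lh₂)) (Q₁ - Q₂); rw [abs_neg] at this; linarith
    _ ≤ _ := by nlinarith [hLdiff, hQdiff, t1, t2, e0]

end WakeRatchetRelayNonlinearMap

end Summit.NavierStokesRegularity.NavierStokesRegularity.Theorems

end
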